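import Literature.AlgebraicGeometry.HodgeTheory.LefschetzPencilHyperplaneSectionsProofs
import HarnessLib

/-!
# Route `SecondaryPeriods`, crux `ConiveauOneFailure` (stmt-HodgeConjecture-3540), line `birth` —
# stub S2a `stub_curveOnSurface_injective`: a curve on every surface, injective on `H¹`

Every smooth projective surface `S/ℂ` receives a morphism `i : C ⟶ S` from a smooth projective
curve `C` such that the pull-back `i^* : H¹(S(ℂ); ℂ) → H¹(C(ℂ); ℂ)` (`complexBetti.map i 1`) is
injective. Proof: take the net `N : FiberNet 1 1 S` of a Lefschetz pencil of hyperplane sections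
with weak Lefschetz through the blow-down (the tree's PROVED named fact
`exists_fiberNet_pencil_weakLefschetz_holds` with `r = 1`: Voisin, *Hodge Theory II*, §2.1.1 and
Thm. 1.23; Bertini, Hartshorne II Thm. 8.18); its discriminant is a proper closed subset of `ℙ¹`
in characteristic `0` (`FiberNet.discriminant_ne_univ_of_charZero`, generic smoothness), so some
complex point `t ∈ ℙ¹(ℂ)` lies in the smooth base (`exists_complexPoint_pt_not_mem`); the fibre
`C = π⁻¹(t)` is a smooth projective curve (`FiberNet.isSmoothProjective_fiber_of_mem_smoothBase`)
and `i = (π⁻¹(t) ⟶ S̃ ⟶ S)` is injective on `H¹` by weak Lefschetz in degree `r = 1`.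

This is hypothesis h₂ of `carriedByCurveCorrespondences_of_transfers` in the line's skeleton
(`Cruxes/ConiveauOneFailure/Lines/birth.lean`).

## References

* [VoisinHodgeII2003] C. Voisin, Hodge Theory and Complex Algebraic Geometry II (2003), §2.1.1,
  §1.2.2 Thm. 1.23.
* [Hartshorne1977] R. Hartshorne, Algebraic Geometry (1977), II Thm. 8.18, III Cor. 10.7.
-/

noncomputable section

-- every declaration of this problem lives in `Summit.HodgeConjecture.HodgeConjecture.…` (summit =
-- sub-problem), which `linter.dupNamespace` flags
set_option linter.dupNamespace false

namespace Summit.HodgeConjecture.HodgeConjecture.Theorems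

open CategoryTheory AlgebraicGeometry
open Literature.AlgebraicGeometry.Motives Literature.AlgebraicGeometry.HodgeTheory
  Literature.AlgebraicTopology.SingularHomology

/-- **A curve on every surface, injective on `H¹`** (stub S2a of the line `birth` of the crux
`ConiveauOneFailure`). Every smooth projective surface `S/ℂ` receives a morphism `i : C ⟶ S` from a
smooth projective curve `C` with `i^* : H¹(S(ℂ); ℂ) → H¹(C(ℂ); ℂ)` injective: `C = π⁻¹(t)` is a
smooth member of a Lefschetz pencil of hyperplane sections of `S`, mapped through the blow-down
`S̃ ⟶ S` (`exists_fiberNet_pencil_weakLefschetz_holds` with `r = 1`; a complex point `t` of the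
smooth base exists because the discriminant is a proper closed subset of `ℙ¹`,
`FiberNet.discriminant_ne_univ_of_charZero` and `exists_complexPoint_pt_not_mem`; the fibre is a
smooth projective curve by `FiberNet.isSmoothProjective_fiber_of_mem_smoothBase`).
[cite: VoisinHodgeII2003, §1.2.2 Thm. 1.23 and §2.1.1] [cite: Hartshorne1977, II Thm. 8.18] -/
theorem stub_curveOnSurface_injective :
    ∀ ⦃S : SchemeOver ℂ⦄, IsSmoothProjective 2 S →
      ∃ (C : SchemeOver ℂ) (_ : IsSmoothProjective 1 C) (i : C ⟶ S),
        Function.Injective (complexBetti.map i 1) := by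
  intro S hS
  obtain ⟨N, hN⟩ := exists_fiberNet_pencil_weakLefschetz_holds 1 le_rfl hS
  haveI : LocallyOfFiniteType (projectiveSpace 1 ℂ).hom :=
    locallyOfFiniteType_of_isSmoothProjective (isSmoothProjective_projectiveSpace_holds ℂ 1)
  obtain ⟨t, ht⟩ := exists_complexPoint_pt_not_mem N.isClosed_discriminant
    N.discriminant_ne_univ_of_charZero
  exact ⟨N.fiber t, N.isSmoothProjective_fiber_of_mem_smoothBase t ht,
    fiberι N.proj t ≫ N.blowDown, (hN t ht).2⟩

end Summit.HodgeConjecture.HodgeConjecture.Theorems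

end
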